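import Literature.MathematicalPhysics.QuantumLattice.HubbardNNNHoppingTorusLimitCorrelator
import Literature.MathematicalPhysics.QuantumLattice.HubbardAffineOrbitCorrelatorCertificate
import Summits.Ventures.CertifiedManyBodySolver.Statement

/-!
# Thermodynamic-limit CORRELATOR row predicates AWAY FROM HALF FILLING: the doped Hubbard chain at
# filling `p/q` (M1 doped cells) and the `t–t'` square lattice at density `n` (M3′ cells) — rational
# slots, energy hypothesis explicit, verbatim binder shapes of the tree soundness theorems

HONEST FRAMING: first certified bounds; not a superconductivity verdict; every number certified or
labelled float.

WHAT THIS FILE IS (BOARD D-8; lead D-19 r92 (c), 2026-08-21). `Statement.lean` §S1–§S2 type the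
half-filling torus-limit correlator rows (`ChainCorrLowerRow`, `SquareCorrLowerRow`: the state class is
"torus limits of THE unit ground state of the even tori", Lieb uniqueness), and §S3 the FINITE-TORUS
orbit-state rows of the M3′ point (`M3TorusCorrLowerRow`). The tree now proves the two
thermodynamic-limit edges that survive degeneracy (no uniqueness away from half filling):

* `InfVolFermionState.IsTorusLimitOf.re_expect_ge_of_chain_window_certificate_ineq_filling`
  (`HubbardAffineOrbitCorrelatorCertificate`, p247795): Hubbard chain, hopping `t`, filling `p/q` —
  for EVERY torus limit `ω` of unit ground states of the sectors `(2·nh_j, S^z = 0)`,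
  `2·nh_j = p·m_j`, of the rings `ℤ/(q·m_j)ℤ`, `m_j → ∞`, GIVEN
  `hubbardChainEnergyDensityAt t U p q ≤ u`: `c − Σ‖aₖ‖ + (Σμ)(p/(2q) − ν) ≤ Re ω(X)`; and its
  reflection-orbit-mean parent `…re_sum_expect_aff_ge_of_chain_window_certificate_ineq`;
* `InfVolFermionState.IsTorusLimitOf.re_expect_ge_of_window_certificate_TT'_ineq`
  (`HubbardNNNHoppingTorusLimitCorrelator`, p246862): square lattice, hoppings `t, t'`, density
  `0 ≤ n < 2` — for EVERY torus limit `ω` of unit ground states of the sectors `(rectN n L_j, S^z = 0)`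
  of `hubbardTorusTT' L_j t t' U`, `L_j → ∞`, GIVEN `energyDensityTT' t t' U n ≤ u`:
  `… ≤ Re ω(X)`; and its `D₄`-orbit-mean parent `…re_sum_expect_d4_ge_of_window_certificate_TT'_ineq`
  (the honest conclusion of a point-group-reduced certificate when `ω` need not be `D₄`-invariant).

This file gives the matching ROW PREDICATES with explicit rational slots — §A `ChainFillingCorrLowerRow /
UpperRow / OrbitLowerRow` (+ the M1 doped docc cells), §B `SquareTTPrimeCorrLowerRow / UpperRow /
OrbitLowerRow` (+ the M3′ cells `M3CorrLowerRow/UpperRow/OrbitLowerRow` at `U = 8`, `n = 7/8` and the docc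
cells) — whose binder lists are VERBATIM the trailing binders of the soundness theorems (so a
`Certificates/` instance is `fun ω … hu => <soundness theorem> … hcert …`), together with the solver-free
edges between them: upper rows from lower rows of `−X` (linearity of `ω.expect`), monotonicity in the
slots, the orbit rows at the trivial label set `S = {1}` ARE the plain rows, the UNCONDITIONAL shape
obtained by discharging the energy hypothesis with a typed energy UPPER row (`M1DopedEnergyUpperRow`,
`M3EnergyUpperRow` of `Statement.lean`), and NON-VACUITY: the state classes are inhabited
(`exists_isTorusLimitOf_sectorGroundState_chain_filling`, `exists_isTorusLimitOf_sectorGroundState_TT'`),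
so a typed lower slot never exceeds a typed upper slot once the energy hypothesis holds.

NOTHING IS ASSERTED HERE: every bound-valued statement is a `def … : Prop` or takes row predicates as
hypotheses; rows are instantiated only under `Certificates/` from certificate files through the named
soundness theorems. No `sorry`, no new axiom, no named fact.
-/

noncomputable section

namespace Summit.Ventures.CertifiedManyBodySolver

open Literature.MathematicalPhysics.QuantumLattice
open Matrix HubbardWave0 Literature.Probability.LatticeModels ThermodynamicLimit Filter Topology
open scoped BigOperators

/-! ## §A  The doped Hubbard chain (`t = 1`, coupling `U`, filling `p/q`) -/

section Chain

/-- §A (LOWER form). Hubbard chain `ℤ`, `t = 1`, coupling `U`, filling `p/q` (density `p/q` electrons per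
site, i.e. `2·nh = p·m` electrons on the ring of length `q·m`): for every torus limit `ω` of unit ground
states `ψ` of the sectors `(2·nh_j, S^z = 0)` of `hubbardTorus 1 (q·m_j) 1 U` along `m_j → ∞`, GIVEN
`hubbardChainEnergyDensityAt 1 U p q ≤ u`, the window observable `X` on the finite support `Λ` has
`r ≤ Re ω(X)`. Verbatim trailing-binder shape of
`InfVolFermionState.IsTorusLimitOf.re_expect_ge_of_chain_window_certificate_ineq_filling`. -/
def ChainFillingCorrLowerRow (U : ℝ) (p q : ℕ) (u r : ℚ) (Λ : Finset (Site 1)) (X : FermionOp Λ) : Prop :=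
  ∀ (ω : InfVolFermionState 1) (mseq nh : ℕ → ℕ) (ψ : ∀ L, Fock (Orb (FermionTorus 1 L))),
    Tendsto mseq atTop atTop → (∀ j, 2 * nh j = p * mseq j) →
    (∀ j, IsGroundStateInSector (hubbardTorus 1 (q * mseq j) 1 U) (2 * nh j) 0 (ψ (q * mseq j))) →
    (∀ j, star (ψ (q * mseq j)) ⬝ᵥ ψ (q * mseq j) = 1) →
    ω.IsTorusLimitOf ψ (fun j => q * mseq j) →
    hubbardChainEnergyDensityAt 1 U p q ≤ ((u : ℚ) : ℝ) →
    ((r : ℚ) : ℝ) ≤ (ω.expect Λ X).re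

/-- §A (UPPER form): same state class and energy hypothesis, conclusion `Re ω(X) ≤ r`. -/
def ChainFillingCorrUpperRow (U : ℝ) (p q : ℕ) (u r : ℚ) (Λ : Finset (Site 1)) (X : FermionOp Λ) : Prop :=
  ∀ (ω : InfVolFermionState 1) (mseq nh : ℕ → ℕ) (ψ : ∀ L, Fock (Orb (FermionTorus 1 L))),
    Tendsto mseq atTop atTop → (∀ j, 2 * nh j = p * mseq j) →
    (∀ j, IsGroundStateInSector (hubbardTorus 1 (q * mseq j) 1 U) (2 * nh j) 0 (ψ (q * mseq j))) →
    (∀ j, star (ψ (q * mseq j)) ⬝ᵥ ψ (q * mseq j) = 1) →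
    ω.IsTorusLimitOf ψ (fun j => q * mseq j) →
    hubbardChainEnergyDensityAt 1 U p q ≤ ((u : ℚ) : ℝ) →
    (ω.expect Λ X).re ≤ ((r : ℚ) : ℝ)

/-- §A (REFLECTION-ORBIT-MEAN form, the honest conclusion of a reflection-reduced certificate): same
state class and energy hypothesis, conclusion
`r ≤ |S|⁻¹ Σ_{ε ∈ S} Re ω_{εΛ}(Γ(affEmb ε 0) X)` for the label set `S ⊆ ℤˣ`. Verbatim trailing-binder
shape of `InfVolFermionState.IsTorusLimitOf.re_sum_expect_aff_ge_of_chain_window_certificate_ineq`. -/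
def ChainFillingCorrOrbitLowerRow (U : ℝ) (p q : ℕ) (u r : ℚ) (S : Finset ℤˣ) (Λ : Finset (Site 1))
    (X : FermionOp Λ) : Prop :=
  ∀ (ω : InfVolFermionState 1) (mseq nh : ℕ → ℕ) (ψ : ∀ L, Fock (Orb (FermionTorus 1 L))),
    Tendsto mseq atTop atTop → (∀ j, 2 * nh j = p * mseq j) →
    (∀ j, IsGroundStateInSector (hubbardTorus 1 (q * mseq j) 1 U) (2 * nh j) 0 (ψ (q * mseq j))) →
    (∀ j, star (ψ (q * mseq j)) ⬝ᵥ ψ (q * mseq j) = 1) →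
    ω.IsTorusLimitOf ψ (fun j => q * mseq j) →
    hubbardChainEnergyDensityAt 1 U p q ≤ ((u : ℚ) : ℝ) →
    ((r : ℚ) : ℝ) ≤ (S.card : ℝ)⁻¹ *
      ∑ e ∈ S, (ω.expect (affShiftSet e 0 Λ) (fermionEmbed (PolySite.affEmb e 0 Λ) X)).re

/-- M1 doped double-occupancy LOWER cell at filling `p/q` (cells `M1-docc-U<U>-n<p/q>`):
`r ≤ Re ω(n_{0↑}n_{0↓})` given `e(p/q; U) ≤ u`. -/
def M1DopedDoccLowerRow (U : ℝ) (p q : ℕ) (u r : ℚ) : Prop :=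
  ChainFillingCorrLowerRow U p q u r {0} (doccAt0 1)

/-- M1 doped double-occupancy UPPER cell at filling `p/q` (energy hypothesis explicit, D-4). -/
def M1DopedDoccUpperRow (U : ℝ) (p q : ℕ) (u r : ℚ) : Prop :=
  ChainFillingCorrUpperRow U p q u r {0} (doccAt0 1)

variable {U : ℝ} {p q : ℕ} {u u' r r' : ℚ} {Λ : Finset (Site 1)} {X : FermionOp Λ}

/-- UPPER rows from LOWER rows on the negated objective (how the substrate's `…_Dup` / `_Sup` files are
read): `−r ≤ Re ω(−X)` is `Re ω(X) ≤ r`. -/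
theorem ChainFillingCorrUpperRow.of_lower_neg (h : ChainFillingCorrLowerRow U p q u (-r) Λ (-X)) :
    ChainFillingCorrUpperRow U p q u r Λ X := by
  intro ω mseq nh ψ hm hnh hψ hψ1 hω hu
  have hh := h ω mseq nh ψ hm hnh hψ hψ1 hω hu
  rw [map_neg, Complex.neg_re] at hh
  push_cast at hh
  linarith

/-- Conversely, a LOWER row is an upper row on the negated objective. -/
theorem ChainFillingCorrLowerRow.of_upper_neg (h : ChainFillingCorrUpperRow U p q u (-r) Λ (-X)) :
    ChainFillingCorrLowerRow U p q u r Λ X := by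
  intro ω mseq nh ψ hm hnh hψ hψ1 hω hu
  have hh := h ω mseq nh ψ hm hnh hψ hψ1 hω hu
  rw [map_neg, Complex.neg_re] at hh
  push_cast at hh
  linarith

/-- A lower row survives a SMALLER energy-hypothesis value `u' ≤ u` (fewer states qualify) and a
SMALLER slot `r' ≤ r`. -/
theorem ChainFillingCorrLowerRow.mono (h : ChainFillingCorrLowerRow U p q u r Λ X) (hu : u' ≤ u)
    (hr : r' ≤ r) : ChainFillingCorrLowerRow U p q u' r' Λ X := by
  intro ω mseq nh ψ hm hnh hψ hψ1 hω hu'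
  have hh := h ω mseq nh ψ hm hnh hψ hψ1 hω (hu'.trans (by exact_mod_cast hu))
  exact le_trans (by exact_mod_cast hr) hh

/-- An upper row survives a smaller energy-hypothesis value `u' ≤ u` and a LARGER slot `r ≤ r'`. -/
theorem ChainFillingCorrUpperRow.mono (h : ChainFillingCorrUpperRow U p q u r Λ X) (hu : u' ≤ u)
    (hr : r ≤ r') : ChainFillingCorrUpperRow U p q u' r' Λ X := by
  intro ω mseq nh ψ hm hnh hψ hψ1 hω hu'
  have hh := h ω mseq nh ψ hm hnh hψ hψ1 hω (hu'.trans (by exact_mod_cast hu))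
  exact hh.trans (by exact_mod_cast hr)

/-- The orbit row at the TRIVIAL label set `S = {1}` (translation-only certificates) IS the plain lower
row: `Γ(affEmb 1 0 Λ) X` has the same expectation as `X` in every infinite-volume state
(`InfVolFermionState.expect_fermionEmbed_affEmb_one_zero`). -/
theorem chainFillingCorrOrbitLowerRow_singleton_one_iff :
    ChainFillingCorrOrbitLowerRow U p q u r {1} Λ X ↔ ChainFillingCorrLowerRow U p q u r Λ X := by
  unfold ChainFillingCorrOrbitLowerRow ChainFillingCorrLowerRow
  simp only [Finset.sum_singleton, Finset.card_singleton, Nat.cast_one, inv_one, one_mul,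
    InfVolFermionState.expect_fermionEmbed_affEmb_one_zero]

/-- UNCONDITIONAL SHAPE: a lower row whose energy hypothesis is discharged by a typed doped energy UPPER
row `M1DopedEnergyUpperRow U p q hi` with `hi ≤ u` bounds `Re ω(X)` for EVERY state of the class — no
energy hypothesis left in the conclusion. -/
theorem ChainFillingCorrLowerRow.uncond (h : ChainFillingCorrLowerRow U p q u r Λ X) {hi : ℚ}
    (hE : M1DopedEnergyUpperRow U p q hi) (hhi : hi ≤ u) :
    ∀ (ω : InfVolFermionState 1) (mseq nh : ℕ → ℕ) (ψ : ∀ L, Fock (Orb (FermionTorus 1 L))),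
      Tendsto mseq atTop atTop → (∀ j, 2 * nh j = p * mseq j) →
      (∀ j, IsGroundStateInSector (hubbardTorus 1 (q * mseq j) 1 U) (2 * nh j) 0 (ψ (q * mseq j))) →
      (∀ j, star (ψ (q * mseq j)) ⬝ᵥ ψ (q * mseq j) = 1) →
      ω.IsTorusLimitOf ψ (fun j => q * mseq j) →
      ((r : ℚ) : ℝ) ≤ (ω.expect Λ X).re :=
  fun ω mseq nh ψ hm hnh hψ hψ1 hω =>
    h ω mseq nh ψ hm hnh hψ hψ1 hω ((show hubbardChainEnergyDensityAt 1 U p q ≤ ((hi : ℚ) : ℝ) from hE).trans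
      (by exact_mod_cast hhi))

/-- The same for upper rows. -/
theorem ChainFillingCorrUpperRow.uncond (h : ChainFillingCorrUpperRow U p q u r Λ X) {hi : ℚ}
    (hE : M1DopedEnergyUpperRow U p q hi) (hhi : hi ≤ u) :
    ∀ (ω : InfVolFermionState 1) (mseq nh : ℕ → ℕ) (ψ : ∀ L, Fock (Orb (FermionTorus 1 L))),
      Tendsto mseq atTop atTop → (∀ j, 2 * nh j = p * mseq j) →
      (∀ j, IsGroundStateInSector (hubbardTorus 1 (q * mseq j) 1 U) (2 * nh j) 0 (ψ (q * mseq j))) →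
      (∀ j, star (ψ (q * mseq j)) ⬝ᵥ ψ (q * mseq j) = 1) →
      ω.IsTorusLimitOf ψ (fun j => q * mseq j) →
      (ω.expect Λ X).re ≤ ((r : ℚ) : ℝ) :=
  fun ω mseq nh ψ hm hnh hψ hψ1 hω =>
    h ω mseq nh ψ hm hnh hψ hψ1 hω ((show hubbardChainEnergyDensityAt 1 U p q ≤ ((hi : ℚ) : ℝ) from hE).trans
      (by exact_mod_cast hhi))

/-- NON-VACUITY ⇒ CONSISTENCY OF THE SLOTS: the state class of §A is inhabited for `1 ≤ q`, `p ≤ 2q`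
(`exists_isTorusLimitOf_sectorGroundState_chain_filling`: rings `q·2(k+1)` with `2p(k+1)` electrons,
weak-⋆ compactness), so once the energy hypothesis holds a typed LOWER slot never exceeds a typed UPPER
slot on the same objective. (A certificate pair with `r' < r` would therefore REFUTE
`hubbardChainEnergyDensityAt 1 U p q ≤ u` — an event, not a bracket.) -/
theorem ChainFillingCorrLowerRow.le_of_upperRow (hl : ChainFillingCorrLowerRow U p q u r Λ X)
    (hu' : ChainFillingCorrUpperRow U p q u r' Λ X) (hq : 1 ≤ q) (hp : p ≤ 2 * q)
    (he : hubbardChainEnergyDensityAt 1 U p q ≤ ((u : ℚ) : ℝ)) : r ≤ r' := by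
  obtain ⟨ψ, φ, ω, hφ, hψ, hψ1, hω, -, -⟩ := exists_isTorusLimitOf_sectorGroundState_chain_filling 1 U hq hp
  have hm : Tendsto (fun j => 2 * (φ j + 1)) atTop atTop := by
    refine tendsto_atTop_mono (fun k => ?_) tendsto_id
    show k ≤ 2 * (φ k + 1)
    have hk : k ≤ φ k := hφ.id_le k
    omega
  have hnh : ∀ j, 2 * (p * (φ j + 1)) = p * (2 * (φ j + 1)) := fun j => by ring
  have h1 := hl ω (fun j => 2 * (φ j + 1)) (fun j => p * (φ j + 1)) ψ hm hnh hψ hψ1 hω he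
  have h2 := hu' ω (fun j => 2 * (φ j + 1)) (fun j => p * (φ j + 1)) ψ hm hnh hψ hψ1 hω he
  exact_mod_cast h1.trans h2

end Chain

/-! ## §B  The `t–t'` square lattice (`t = 1`, NNN hopping `tp`, coupling `U`, density `n`) -/

section Square

/-- §B (LOWER form). Square lattice `ℤ²`, `t = 1`, next-nearest-neighbour hopping `tp`, coupling `U`,
density `n` (the sectors `(rectN n L, S^z = 0)`, `rectN n L = 2⌊n L²/2⌋`): for every torus limit `ω`
of unit ground states `ψ` of the sectors `(rectN n L_j, S^z = 0)` of `hubbardTorusTT' L_j 1 tp U` along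
`L_j → ∞`, GIVEN `energyDensityTT' 1 tp U n ≤ u`, `r ≤ Re ω(X)`. Verbatim trailing-binder shape of
`InfVolFermionState.IsTorusLimitOf.re_expect_ge_of_window_certificate_TT'_ineq`. -/
def SquareTTPrimeCorrLowerRow (tp U n : ℝ) (u r : ℚ) (Λ : Finset (Site 2)) (X : FermionOp Λ) : Prop :=
  ∀ (ω : InfVolFermionState 2) (Ls : ℕ → ℕ) (ψ : ∀ L, Fock (Orb (FermionTorus 2 L))),
    Tendsto Ls atTop atTop →
    (∀ j, IsGroundStateInSector (hubbardTorusTT' (Ls j) 1 tp U) (rectN n (Ls j)) 0 (ψ (Ls j))) →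
    (∀ j, star (ψ (Ls j)) ⬝ᵥ ψ (Ls j) = 1) → ω.IsTorusLimitOf ψ Ls →
    energyDensityTT' 1 tp U n ≤ ((u : ℚ) : ℝ) →
    ((r : ℚ) : ℝ) ≤ (ω.expect Λ X).re

/-- §B (UPPER form): same state class and energy hypothesis, conclusion `Re ω(X) ≤ r`. -/
def SquareTTPrimeCorrUpperRow (tp U n : ℝ) (u r : ℚ) (Λ : Finset (Site 2)) (X : FermionOp Λ) : Prop :=
  ∀ (ω : InfVolFermionState 2) (Ls : ℕ → ℕ) (ψ : ∀ L, Fock (Orb (FermionTorus 2 L))),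
    Tendsto Ls atTop atTop →
    (∀ j, IsGroundStateInSector (hubbardTorusTT' (Ls j) 1 tp U) (rectN n (Ls j)) 0 (ψ (Ls j))) →
    (∀ j, star (ψ (Ls j)) ⬝ᵥ ψ (Ls j) = 1) → ω.IsTorusLimitOf ψ Ls →
    energyDensityTT' 1 tp U n ≤ ((u : ℚ) : ℝ) →
    (ω.expect Λ X).re ≤ ((r : ℚ) : ℝ)

/-- §B (`D₄`-ORBIT-MEAN form, the honest conclusion of a point-group-reduced certificate — a torus limit
of sector ground states need not be `D₄`-invariant when the sector ground space is degenerate): same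
state class and energy hypothesis, conclusion `r ≤ |S|⁻¹ Σ_{γ ∈ S} Re ω_{γΛ}(Γ(d4Emb γ 0) X)` for the
label set `S ⊆ D₄`. Verbatim trailing-binder shape of
`InfVolFermionState.IsTorusLimitOf.re_sum_expect_d4_ge_of_window_certificate_TT'_ineq`. -/
def SquareTTPrimeCorrOrbitLowerRow (tp U n : ℝ) (u r : ℚ) (S : Finset (DihedralGroup 4))
    (Λ : Finset (Site 2)) (X : FermionOp Λ) : Prop :=
  ∀ (ω : InfVolFermionState 2) (Ls : ℕ → ℕ) (ψ : ∀ L, Fock (Orb (FermionTorus 2 L))),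
    Tendsto Ls atTop atTop →
    (∀ j, IsGroundStateInSector (hubbardTorusTT' (Ls j) 1 tp U) (rectN n (Ls j)) 0 (ψ (Ls j))) →
    (∀ j, star (ψ (Ls j)) ⬝ᵥ ψ (Ls j) = 1) → ω.IsTorusLimitOf ψ Ls →
    energyDensityTT' 1 tp U n ≤ ((u : ℚ) : ℝ) →
    ((r : ℚ) : ℝ) ≤ (S.card : ℝ)⁻¹ *
      ∑ g ∈ S, (ω.expect (d4ShiftSet g 0 Λ) (fermionEmbed (PolySite.d4Emb g 0 Λ) X)).re

/-- M3′ TL correlator LOWER cell at the canonical point `U = 8`, `n = 7/8` (δ = 1/8), NNN hopping `tp`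
(`tp ∈ {0, −1/4}`): `r ≤ Re ω(X)` given `e₀(U = 8, n = 7/8, tp) ≤ u` — the thermodynamic-limit companion
of `M3TorusCorrLowerRow` (finite tori); pairing / stripe / docc words `X` from the m3 operator sets. -/
def M3CorrLowerRow (tp : ℝ) (u r : ℚ) (Λ : Finset (Site 2)) (X : FermionOp Λ) : Prop :=
  SquareTTPrimeCorrLowerRow tp 8 (7 / 8) u r Λ X

/-- M3′ TL correlator UPPER cell at the canonical point (energy hypothesis explicit, D-4). -/
def M3CorrUpperRow (tp : ℝ) (u r : ℚ) (Λ : Finset (Site 2)) (X : FermionOp Λ) : Prop :=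
  SquareTTPrimeCorrUpperRow tp 8 (7 / 8) u r Λ X

/-- M3′ TL correlator `D₄`-ORBIT-MEAN cell at the canonical point (for `D₄`-reduced certificates). -/
def M3CorrOrbitLowerRow (tp : ℝ) (u r : ℚ) (S : Finset (DihedralGroup 4)) (Λ : Finset (Site 2))
    (X : FermionOp Λ) : Prop :=
  SquareTTPrimeCorrOrbitLowerRow tp 8 (7 / 8) u r S Λ X

/-- M3′ double-occupancy LOWER cell at the canonical point: `r ≤ Re ω(n_{0↑}n_{0↓})` given `e₀ ≤ u`. -/
def M3DoccLowerRow (tp : ℝ) (u r : ℚ) : Prop := M3CorrLowerRow tp u r {0} (doccAt0 2)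

/-- M3′ double-occupancy UPPER cell at the canonical point. -/
def M3DoccUpperRow (tp : ℝ) (u r : ℚ) : Prop := M3CorrUpperRow tp u r {0} (doccAt0 2)

variable {tp U n : ℝ} {u u' r r' : ℚ} {Λ : Finset (Site 2)} {X : FermionOp Λ}

/-- UPPER rows from LOWER rows on the negated objective. -/
theorem SquareTTPrimeCorrUpperRow.of_lower_neg (h : SquareTTPrimeCorrLowerRow tp U n u (-r) Λ (-X)) :
    SquareTTPrimeCorrUpperRow tp U n u r Λ X := by
  intro ω Ls ψ hLs hψ hψ1 hω hu
  have hh := h ω Ls ψ hLs hψ hψ1 hω hu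
  rw [map_neg, Complex.neg_re] at hh
  push_cast at hh
  linarith

/-- LOWER rows from UPPER rows on the negated objective. -/
theorem SquareTTPrimeCorrLowerRow.of_upper_neg (h : SquareTTPrimeCorrUpperRow tp U n u (-r) Λ (-X)) :
    SquareTTPrimeCorrLowerRow tp U n u r Λ X := by
  intro ω Ls ψ hLs hψ hψ1 hω hu
  have hh := h ω Ls ψ hLs hψ hψ1 hω hu
  rw [map_neg, Complex.neg_re] at hh
  push_cast at hh
  linarith

/-- Monotonicity of a lower row in its slots (`u' ≤ u`, `r' ≤ r`). -/
theorem SquareTTPrimeCorrLowerRow.mono (h : SquareTTPrimeCorrLowerRow tp U n u r Λ X) (hu : u' ≤ u)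
    (hr : r' ≤ r) : SquareTTPrimeCorrLowerRow tp U n u' r' Λ X := by
  intro ω Ls ψ hLs hψ hψ1 hω hu'
  have hh := h ω Ls ψ hLs hψ hψ1 hω (hu'.trans (by exact_mod_cast hu))
  exact le_trans (by exact_mod_cast hr) hh

/-- Monotonicity of an upper row in its slots (`u' ≤ u`, `r ≤ r'`). -/
theorem SquareTTPrimeCorrUpperRow.mono (h : SquareTTPrimeCorrUpperRow tp U n u r Λ X) (hu : u' ≤ u)
    (hr : r ≤ r') : SquareTTPrimeCorrUpperRow tp U n u' r' Λ X := by
  intro ω Ls ψ hLs hψ hψ1 hω hu'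
  have hh := h ω Ls ψ hLs hψ hψ1 hω (hu'.trans (by exact_mod_cast hu))
  exact hh.trans (by exact_mod_cast hr)

/-- The `D₄`-orbit row at the TRIVIAL label set `S = {1}` (translation-only certificates) IS the plain
lower row (`InfVolFermionState.expect_fermionEmbed_d4Emb_one_zero`). -/
theorem squareTTPrimeCorrOrbitLowerRow_singleton_one_iff :
    SquareTTPrimeCorrOrbitLowerRow tp U n u r {1} Λ X ↔ SquareTTPrimeCorrLowerRow tp U n u r Λ X := by
  unfold SquareTTPrimeCorrOrbitLowerRow SquareTTPrimeCorrLowerRow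
  simp only [Finset.sum_singleton, Finset.card_singleton, Nat.cast_one, inv_one, one_mul,
    InfVolFermionState.expect_fermionEmbed_d4Emb_one_zero]

/-- An orbit row for an `ω`-INVARIANT family of rotated copies is the plain row: if every state of the
class takes the same value on each `Γ(d4Emb γ 0) X ∈ 𝔄_{γΛ}`, `γ ∈ S`, as on `X` (e.g. `X` itself
`D₄`-symmetric up to the translation invariance of torus limits), the orbit mean is `Re ω(X)`. Stated
with the invariance as an explicit hypothesis on the class. -/
theorem SquareTTPrimeCorrOrbitLowerRow.lowerRow_of_invariant {S : Finset (DihedralGroup 4)}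
    (h : SquareTTPrimeCorrOrbitLowerRow tp U n u r S Λ X) (hS : S.Nonempty)
    (hinv : ∀ (ω : InfVolFermionState 2) (Ls : ℕ → ℕ) (ψ : ∀ L, Fock (Orb (FermionTorus 2 L))),
      Tendsto Ls atTop atTop →
      (∀ j, IsGroundStateInSector (hubbardTorusTT' (Ls j) 1 tp U) (rectN n (Ls j)) 0 (ψ (Ls j))) →
      (∀ j, star (ψ (Ls j)) ⬝ᵥ ψ (Ls j) = 1) → ω.IsTorusLimitOf ψ Ls →
      ∀ g ∈ S, ω.expect (d4ShiftSet g 0 Λ) (fermionEmbed (PolySite.d4Emb g 0 Λ) X) = ω.expect Λ X) :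
    SquareTTPrimeCorrLowerRow tp U n u r Λ X := by
  intro ω Ls ψ hLs hψ hψ1 hω hu
  have hh := h ω Ls ψ hLs hψ hψ1 hω hu
  have hsum : ∑ g ∈ S, (ω.expect (d4ShiftSet g 0 Λ) (fermionEmbed (PolySite.d4Emb g 0 Λ) X)).re =
      ∑ g ∈ S, (ω.expect Λ X).re :=
    Finset.sum_congr rfl fun g hg => by rw [hinv ω Ls ψ hLs hψ hψ1 hω g hg]
  have hc : (S.card : ℝ) ≠ 0 := by exact_mod_cast hS.card_pos.ne'
  rwa [hsum, Finset.sum_const, nsmul_eq_mul, ← mul_assoc, inv_mul_cancel₀ hc, one_mul] at hh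

/-- UNCONDITIONAL SHAPE at the M3′ point: a lower cell whose energy hypothesis is discharged by a typed
`M3EnergyUpperRow tp hi` (`Statement.lean`) with `hi ≤ u` bounds `Re ω(X)` for EVERY state of the class. -/
theorem M3CorrLowerRow.uncond (h : M3CorrLowerRow tp u r Λ X) {hi : ℚ} (hE : M3EnergyUpperRow tp hi)
    (hhi : hi ≤ u) :
    ∀ (ω : InfVolFermionState 2) (Ls : ℕ → ℕ) (ψ : ∀ L, Fock (Orb (FermionTorus 2 L))),
      Tendsto Ls atTop atTop →
      (∀ j, IsGroundStateInSector (hubbardTorusTT' (Ls j) 1 tp 8) (rectN (7 / 8) (Ls j)) 0 (ψ (Ls j))) →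
      (∀ j, star (ψ (Ls j)) ⬝ᵥ ψ (Ls j) = 1) → ω.IsTorusLimitOf ψ Ls →
      ((r : ℚ) : ℝ) ≤ (ω.expect Λ X).re :=
  fun ω Ls ψ hLs hψ hψ1 hω =>
    h ω Ls ψ hLs hψ hψ1 hω ((show energyDensityTT' 1 tp 8 (7 / 8) ≤ ((hi : ℚ) : ℝ) from hE).trans
      (by exact_mod_cast hhi))

/-- The same for upper cells. -/
theorem M3CorrUpperRow.uncond (h : M3CorrUpperRow tp u r Λ X) {hi : ℚ} (hE : M3EnergyUpperRow tp hi)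
    (hhi : hi ≤ u) :
    ∀ (ω : InfVolFermionState 2) (Ls : ℕ → ℕ) (ψ : ∀ L, Fock (Orb (FermionTorus 2 L))),
      Tendsto Ls atTop atTop →
      (∀ j, IsGroundStateInSector (hubbardTorusTT' (Ls j) 1 tp 8) (rectN (7 / 8) (Ls j)) 0 (ψ (Ls j))) →
      (∀ j, star (ψ (Ls j)) ⬝ᵥ ψ (Ls j) = 1) → ω.IsTorusLimitOf ψ Ls →
      (ω.expect Λ X).re ≤ ((r : ℚ) : ℝ) :=
  fun ω Ls ψ hLs hψ hψ1 hω =>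
    h ω Ls ψ hLs hψ hψ1 hω ((show energyDensityTT' 1 tp 8 (7 / 8) ≤ ((hi : ℚ) : ℝ) from hE).trans
      (by exact_mod_cast hhi))

/-- NON-VACUITY ⇒ CONSISTENCY OF THE SLOTS (§B): for `0 ≤ n ≤ 2` the state class is inhabited along
every `Ls → ∞` (`exists_isTorusLimitOf_sectorGroundState_TT'`), so once the energy hypothesis holds a
typed LOWER slot never exceeds a typed UPPER slot on the same objective. -/
theorem SquareTTPrimeCorrLowerRow.le_of_upperRow (hl : SquareTTPrimeCorrLowerRow tp U n u r Λ X)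
    (hu' : SquareTTPrimeCorrUpperRow tp U n u r' Λ X) (hn0 : 0 ≤ n) (hn2 : n ≤ 2)
    (he : energyDensityTT' 1 tp U n ≤ ((u : ℚ) : ℝ)) : r ≤ r' := by
  obtain ⟨ψ, φ, ω, hφ, hψ, hψ1, hω, -, -, -⟩ :=
    exists_isTorusLimitOf_sectorGroundState_TT' 1 tp U hn0 hn2 (Ls := id) tendsto_id
  have hLs : Tendsto (id ∘ φ) atTop atTop := hφ.tendsto_atTop
  have h1 := hl ω (id ∘ φ) ψ hLs (fun j => hψ _) (fun j => hψ1 _) hω he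
  have h2 := hu' ω (id ∘ φ) ψ hLs (fun j => hψ _) (fun j => hψ1 _) hω he
  exact_mod_cast h1.trans h2

/-- In particular at the M3′ point. -/
theorem M3CorrLowerRow.le_of_upperRow (hl : M3CorrLowerRow tp u r Λ X) (hu' : M3CorrUpperRow tp u r' Λ X)
    (he : energyDensityTT' 1 tp 8 (7 / 8) ≤ ((u : ℚ) : ℝ)) : r ≤ r' :=
  SquareTTPrimeCorrLowerRow.le_of_upperRow hl hu' (by norm_num) (by norm_num) he

end Square

end Summit.Ventures.CertifiedManyBodySolver

end
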